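import Mathlib
import Summits.ValiantsHypothesis.ValiantsHypothesis.Theorems.KPlusLogSqLawTridiagonalRealStaticGapProductFullSpan

/-!
# Gap products of a face span WITH HOLES: the universal single-face criterion (arithmetic core of the HOLE CRITERION of the α register)

Sequel of `…TridiagonalRealStaticGapProductFullSpan.lean` (this lineage's ENS / face-rule lane, stmt-ValiantsHypothesis-19561).  There the lattice
span `{0, …, p+q}` of a face with middle values `p < q` was FULLY occupied; here a set `U` of HOLES (unoccupied interior lattice points, none of
them a face point) is allowed, under the HOLE CONDITION
`∏_{i ∈ U} i (p+q−i) ≤ ∏_{i ∈ U} |i − p| |i − q|`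
(the holes' joint gap ratio `∏ ρ(i)`, `ρ(i) = i(p+q−i)/(|i−p||i−q|)`, is at most `1`).  Then still `W(p) · W(q) < W(0) · W(p+q)`
(`gapProduct_holes_int`, `gapProduct_holes`): removing a hole `i` from the full span divides `W(0)W(p+q)` by `i(p+q−i)` and `W(p)W(q)` by
`|i−p||i−q|`, so the full-span factor `C(p+q,p)²` in favour of the extremes survives when `∏ ρ ≤ 1`, and the exterior sides still give strictly
less than `C(p+q,p)` each to the middles.  Holes strictly BETWEEN the middles have `ρ > 1` (they can rescue sharpness); holes between a
middle and the near extreme may have `ρ ≤ 1`.  `U = ∅` is the full-occupancy law.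

HONEST FRAMING: elementary arithmetic; nothing here is about pencils, `WeakLifting`, Conjecture B, `MatrixDescartes` (18050) or `VP ≠ VNP`.
Seat: prover val-sym-lift-p2 g18, `--supports stmt-ValiantsHypothesis-19561`.
-/

set_option linter.dupNamespace false
set_option autoImplicit false

namespace Summit.ValiantsHypothesis.ValiantsHypothesis.Theorems.KPlusLogSqLaw

namespace EdgeNormalForm

open Finset

/-- **SPAN WITH HOLES BEATS THE FACE RULE (integer sets).**  `S ⊆ ℤ` finite; `U ⊆ {1,…,p+q−1} ∖ {p,q}` the holes; `S` contains every
integer of `[0, p+q]` outside `U` and none of `U`; hole condition `∏_U i(p+q−i) ≤ ∏_U |i−p||i−q|`.  Then `W(p)·W(q) < W(0)·W(p+q)`. [this work] -/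
theorem gapProduct_holes_int (p q : ℕ) (hp : 1 ≤ p) (hpq : p < q) (S : Finset ℤ) (U : Finset ℕ)
    (hU : ∀ i ∈ U, 0 < i ∧ i < p + q ∧ i ≠ p ∧ i ≠ q)
    (hJ : ∀ i : ℕ, i ≤ p + q → i ∉ U → (i : ℤ) ∈ S) (hUS : ∀ i ∈ U, (i : ℤ) ∉ S)
    (hρ : (∏ i ∈ U, ((i : ℝ) * ((p + q : ℕ) - (i : ℝ)))) ≤ ∏ i ∈ U, (|(i : ℝ) - p| * |(i : ℝ) - q|)) :
    (∏ w ∈ S.erase (p : ℤ), |((p : ℤ) : ℝ) - w|) * (∏ w ∈ S.erase (q : ℤ), |((q : ℤ) : ℝ) - w|) <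
      (∏ w ∈ S.erase (0 : ℤ), |((0 : ℤ) : ℝ) - w|) * (∏ w ∈ S.erase ((p + q : ℕ) : ℤ), |(((p + q : ℕ) : ℤ) : ℝ) - w|) := by
  set n := p + q with hn
  -- the completed set `T = S ∪ U` has the full span; its gap products factor through those of `S`
  set Uz : Finset ℤ := U.image (fun i : ℕ => (i : ℤ)) with hUz
  have hdisj : Disjoint S Uz := by
    rw [Finset.disjoint_left]
    intro w hwS hwU
    obtain ⟨i, hi, rfl⟩ := Finset.mem_image.mp hwU
    exact hUS i hi hwS
  set T : Finset ℤ := S ∪ Uz with hT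
  have hJT : ∀ i : ℕ, i ≤ n → (i : ℤ) ∈ T := by
    intro i hi
    by_cases hiU : i ∈ U
    · exact Finset.mem_union_right _ (Finset.mem_image.mpr ⟨i, hiU, rfl⟩)
    · exact Finset.mem_union_left _ (hJ i hi hiU)
  have full := gapProduct_fullSpan_int p q hp hpq T hJT
  rw [← hn] at full
  -- for `v ∈ S`: `W_T(v) = W_S(v) · ∏_{i∈U} |v − i|`
  have hWT : ∀ v : ℤ, v ∈ S → ∏ w ∈ T.erase v, |(v : ℝ) - w| = (∏ w ∈ S.erase v, |(v : ℝ) - w|) * ∏ i ∈ U, |(v : ℝ) - (i : ℝ)| := by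
    intro v hv
    have hvU : v ∉ Uz := fun h => (Finset.disjoint_left.mp hdisj) hv h
    rw [hT, Finset.erase_union_distrib, Finset.erase_eq_of_notMem hvU,
      Finset.prod_union (Finset.disjoint_of_subset_left (Finset.erase_subset _ _) hdisj), hUz,
      Finset.prod_image (fun i _ j _ h => by exact_mod_cast h)]
    push_cast
    rfl
  have hpS : (p : ℤ) ∈ S := hJ p (by omega) (fun h => (hU p h).2.2.1 rfl)
  have hqS : (q : ℤ) ∈ S := hJ q (by omega) (fun h => (hU q h).2.2.2 rfl)
  have h0S : ((0 : ℕ) : ℤ) ∈ S := hJ 0 (by omega) (fun h => (lt_irrefl 0) (hU 0 h).1)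
  have hnS : (n : ℤ) ∈ S := hJ n le_rfl (fun h => (lt_irrefl n) (hU n h).2.1)
  rw [Nat.cast_zero] at h0S
  have eP := hWT p hpS
  have eQ := hWT q hqS
  have e0 := hWT 0 h0S
  have eN := hWT n hnS
  push_cast at full eP eQ e0 eN ⊢
  rw [eP, eQ, e0, eN] at full
  -- the hole factors: extremes `∏_U |0−i|·|n−i| = ∏_U i(n−i)`, middles `∏_U |p−i|·|q−i|`
  have hU0 : (∏ i ∈ U, |(0 : ℝ) - (i : ℝ)|) * (∏ i ∈ U, |(n : ℝ) - (i : ℝ)|) = ∏ i ∈ U, ((i : ℝ) * ((n : ℝ) - (i : ℝ))) := by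
    rw [← Finset.prod_mul_distrib]
    refine Finset.prod_congr rfl fun i hi => ?_
    have h1' : (i : ℝ) < n := by exact_mod_cast (hU i hi).2.1
    rw [zero_sub, abs_neg, abs_of_nonneg (by positivity), abs_of_pos (by linarith)]
  have hUm : (∏ i ∈ U, |(p : ℝ) - (i : ℝ)|) * (∏ i ∈ U, |(q : ℝ) - (i : ℝ)|) = ∏ i ∈ U, (|(i : ℝ) - p| * |(i : ℝ) - q|) := by
    rw [← Finset.prod_mul_distrib]
    refine Finset.prod_congr rfl fun i _ => ?_
    rw [abs_sub_comm (p : ℝ), abs_sub_comm (q : ℝ)]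
  have hnn : (n : ℝ) = ((p + q : ℕ) : ℝ) := by rw [hn]
  have hρ' : ∏ i ∈ U, ((i : ℝ) * ((n : ℝ) - (i : ℝ))) ≤ ∏ i ∈ U, (|(i : ℝ) - p| * |(i : ℝ) - q|) := by
    rw [hnn]; exact hρ
  -- positivity of the blocks
  have posS : ∀ v : ℤ, 0 < ∏ w ∈ S.erase v, |(v : ℝ) - w| := fun v =>
    Finset.prod_pos fun w hw => abs_pos.mpr (sub_ne_zero.mpr (by exact_mod_cast (Finset.ne_of_mem_erase hw).symm))
  have posUm : 0 < ∏ i ∈ U, (|(i : ℝ) - p| * |(i : ℝ) - q|) :=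
    Finset.prod_pos fun i hi => mul_pos (abs_pos.mpr (sub_ne_zero.mpr (by exact_mod_cast (hU i hi).2.2.1)))
      (abs_pos.mpr (sub_ne_zero.mpr (by exact_mod_cast (hU i hi).2.2.2)))
  -- rearrange `full` as `(AB)·Dm < (CD)·De`, then use `De ≤ Dm`
  set A := ∏ w ∈ S.erase (p : ℤ), |(p : ℝ) - w|
  set B := ∏ w ∈ S.erase (q : ℤ), |(q : ℝ) - w|
  set C := ∏ w ∈ S.erase (0 : ℤ), |(0 : ℝ) - w|
  set D := ∏ w ∈ S.erase (n : ℤ), |(n : ℝ) - w|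
  have key : (A * B) * ∏ i ∈ U, (|(i : ℝ) - p| * |(i : ℝ) - q|) < (C * D) * ∏ i ∈ U, ((i : ℝ) * ((n : ℝ) - (i : ℝ))) := by
    rw [← hUm, ← hU0]
    calc A * B * ((∏ i ∈ U, |(p : ℝ) - (i : ℝ)|) * ∏ i ∈ U, |(q : ℝ) - (i : ℝ)|)
        = (A * ∏ i ∈ U, |(p : ℝ) - (i : ℝ)|) * (B * ∏ i ∈ U, |(q : ℝ) - (i : ℝ)|) := by ring
      _ < (C * ∏ i ∈ U, |(0 : ℝ) - (i : ℝ)|) * (D * ∏ i ∈ U, |(n : ℝ) - (i : ℝ)|) := full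
      _ = C * D * ((∏ i ∈ U, |(0 : ℝ) - (i : ℝ)|) * ∏ i ∈ U, |(n : ℝ) - (i : ℝ)|) := by ring
  have hC : 0 < C := by have h := posS 0; push_cast at h; exact h
  have hD : 0 < D := by have h := posS n; push_cast at h; exact h
  have hCD : 0 ≤ C * D := (mul_pos hC hD).le
  have h2 : (A * B) * ∏ i ∈ U, (|(i : ℝ) - p| * |(i : ℝ) - q|) < (C * D) * ∏ i ∈ U, (|(i : ℝ) - p| * |(i : ℝ) - q|) :=
    lt_of_lt_of_le key (mul_le_mul_of_nonneg_left hρ' hCD)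
  exact lt_of_mul_lt_mul_right h2 posUm.le

/-- **SPAN WITH HOLES BEATS THE FACE RULE (labelled, lattice form).**  Injective integer labelling `z` of `Act` on the lattice `c + gℤ`; face
members of values `c, c+pg, c+qg, c+(p+q)g`; holes `U` (offsets strictly inside, not `p`, `q`) NOT attained on `Act`, every other interior
offset attained; hole condition `∏_U i(p+q−i) ≤ ∏_U |i−p||i−q|` ⇒ `W_{c+pg}·W_{c+qg} < W_c·W_{c+(p+q)g}`. [this work] -/
theorem gapProduct_holes {ι : Type*} [DecidableEq ι] (Act : Finset ι) (z : ι → ℤ)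
    (hinj : ∀ P ∈ Act, ∀ Q ∈ Act, z P = z Q → P = Q) (p q : ℕ) (hp : 1 ≤ p) (hpq : p < q)
    (c g : ℤ) (hg : 0 < g) (hmod : ∀ Q ∈ Act, g ∣ z Q - c) (U : Finset ℕ)
    (hU : ∀ i ∈ U, 0 < i ∧ i < p + q ∧ i ≠ p ∧ i ≠ q)
    (hocc : ∀ i : ℕ, i ≤ p + q → i ∉ U → ∃ Q ∈ Act, z Q = c + i * g)
    (hhole : ∀ i ∈ U, ∀ Q ∈ Act, z Q ≠ c + i * g)
    (hρ : (∏ i ∈ U, ((i : ℝ) * ((p + q : ℕ) - (i : ℝ)))) ≤ ∏ i ∈ U, (|(i : ℝ) - p| * |(i : ℝ) - q|))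
    {E₁ M₁ M₂ E₂ : ι} (hE₁ : E₁ ∈ Act) (hM₁ : M₁ ∈ Act) (hM₂ : M₂ ∈ Act) (hE₂ : E₂ ∈ Act)
    (zE₁ : z E₁ = c) (zM₁ : z M₁ = c + p * g) (zM₂ : z M₂ = c + q * g) (zE₂ : z E₂ = c + (p + q : ℕ) * g) :
    (∏ Q ∈ Act.erase M₁, |((z M₁ : ℝ)) - z Q|) * (∏ Q ∈ Act.erase M₂, |((z M₂ : ℝ)) - z Q|) <
      (∏ Q ∈ Act.erase E₁, |((z E₁ : ℝ)) - z Q|) * (∏ Q ∈ Act.erase E₂, |((z E₂ : ℝ)) - z Q|) := by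
  set z' : ι → ℤ := fun Q => (z Q - c) / g with hz'
  have hzz' : ∀ Q ∈ Act, z Q = c + g * z' Q := fun Q hQ => by
    have := Int.ediv_mul_cancel (hmod Q hQ); simp only [hz']; linarith [this]
  have hinj' : ∀ P ∈ Act, ∀ Q ∈ Act, z' P = z' Q → P = Q := fun P hP Q hQ h =>
    hinj P hP Q hQ (by rw [hzz' P hP, hzz' Q hQ, h])
  have hg0 : (g : ℤ) ≠ 0 := ne_of_gt hg
  have hval : ∀ Q ∈ Act, ∀ i : ℤ, z Q = c + i * g → z' Q = i := fun Q _ i h => by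
    simp only [hz', h, add_sub_cancel_left, Int.mul_ediv_cancel _ hg0]
  set S : Finset ℤ := Act.image z' with hS
  have hJ : ∀ i : ℕ, i ≤ p + q → i ∉ U → (i : ℤ) ∈ S := by
    intro i hi hiU
    obtain ⟨Q, hQ, hzQ⟩ := hocc i hi hiU
    exact Finset.mem_image.mpr ⟨Q, hQ, hval Q hQ i hzQ⟩
  have hUS : ∀ i ∈ U, (i : ℤ) ∉ S := by
    intro i hi hmem
    obtain ⟨Q, hQ, hzQ⟩ := Finset.mem_image.mp hmem
    exact hhole i hi Q hQ (by rw [hzz' Q hQ, hzQ]; ring)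
  have key := gapProduct_holes_int p q hp hpq S U hU hJ hUS hρ
  have hresc : ∀ P ∈ Act, ∏ Q ∈ Act.erase P, |((z P : ℝ)) - z Q| =
      (g : ℝ) ^ (Act.erase P).card * ∏ w ∈ S.erase (z' P), |((z' P : ℝ)) - w| := by
    intro P hP
    have himg : S.erase (z' P) = (Act.erase P).image z' := by
      ext w
      simp only [hS, Finset.mem_erase, Finset.mem_image]
      constructor
      · rintro ⟨hne, Q, hQ, rfl⟩
        exact ⟨Q, ⟨fun h => hne (by rw [h]), hQ⟩, rfl⟩
      · rintro ⟨Q, ⟨hQP, hQ⟩, rfl⟩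
        exact ⟨fun h => hQP (hinj' Q hQ P hP h), Q, hQ, rfl⟩
    rw [himg, Finset.prod_image (fun Q hQ Q' hQ' h =>
      hinj' Q (Finset.mem_of_mem_erase hQ) Q' (Finset.mem_of_mem_erase hQ') h), Finset.pow_card_mul_prod]
    refine Finset.prod_congr rfl fun Q hQ => ?_
    rw [hzz' P hP, hzz' Q (Finset.mem_of_mem_erase hQ)]
    push_cast
    rw [show ((c : ℝ) + g * (z' P) - (c + g * (z' Q))) = g * ((z' P : ℝ) - z' Q) by ring, abs_mul,
      abs_of_pos (by exact_mod_cast hg : (0 : ℝ) < g)]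
  have hcardP : ∀ P ∈ Act, (Act.erase P).card = Act.card - 1 := fun P hP => Finset.card_erase_of_mem hP
  have v1 : z' E₁ = 0 := hval E₁ hE₁ 0 (by rw [zE₁]; ring)
  have v2 : z' M₁ = p := hval M₁ hM₁ p zM₁
  have v3 : z' M₂ = q := hval M₂ hM₂ q zM₂
  have v4 : z' E₂ = ((p + q : ℕ) : ℤ) := hval E₂ hE₂ _ zE₂
  rw [hresc M₁ hM₁, hresc M₂ hM₂, hresc E₁ hE₁, hresc E₂ hE₂, hcardP M₁ hM₁, hcardP M₂ hM₂, hcardP E₁ hE₁, hcardP E₂ hE₂,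
    v1, v2, v3, v4]
  have hgpos : (0 : ℝ) < (g : ℝ) ^ (Act.card - 1) := pow_pos (by exact_mod_cast hg) _
  nlinarith [mul_pos hgpos hgpos, key]

end EdgeNormalForm

end Summit.ValiantsHypothesis.ValiantsHypothesis.Theorems.KPlusLogSqLaw
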